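import Literature.AlgebraicTopology.CharacteristicClasses.LineThomClassGluing
import Literature.AlgebraicTopology.SingularHomology.CohomologyOpenExhaustion
import Literature.Topology.DisjointCountableRefinement
import HarnessLib

/-!
# Existence of the Thom class of a complex line bundle on its projective completion

D. Husemoller, *Fibre Bundles* (3rd ed. 1994), Ch. 17 §2–§3, with J. Milnor, J. Stasheff,
*Characteristic Classes* (1974), §10 Thm. 10.4 and its proof p. 111–113 ("Existence and
uniqueness of the Thom class … first for bundles of finite type by induction on the number of sets
in a trivialising cover, using Mayer–Vietoris; then for arbitrary [paracompact] base via a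
countable cover `B = ⋃ W_k` in which each `W_k` is a disjoint union of trivialising open sets") —
for a complex LINE bundle `λ` over a paracompact Hausdorff base, in the absolute form on
`D = P(λ ⊕ ℂ)`:

**`exists_isThomClass`**: there is a class `t ∈ H²(P(λ ⊕ ℂ); R)` with `s_∞^* t = 0` and whose
restriction to every fibre `ℙ(λ_b ⊕ ℂ) ≅ ℂP¹` is the canonical generator `ω_b(m)` (`IsThomClass`).

Proof, exactly along Milnor–Stasheff's: (1) the base sets of the atlas trivialisations cover `B`;
Milnor's countable cover by disjoint unions subordinate to it
(`Literature/Topology/DisjointCountableRefinement`); (2) on each disjoint union `W_k` the local Thom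
classes assemble (`exists_isNormalised_iUnion`), and `W_k ∩ V` is a uniqueness domain for every
open `V`; (3) the increasing exhaustion `V_n = W_0 ∪ ⋯ ∪ W_n` carries normalised classes glued
step by step (`exists_isNormalised_union`, Mayer–Vietoris + renormalisation) and EXACTLY compatible
under restriction (`thomSeq`, `thomSeq_restrict`); (4) they lift to one class on `P(λ ⊕ ℂ)`
(`CohomologyOpenExhaustion.exists_forall_map_subsetIncl_eq_of_exhaustion`, the surjectivity half of
Milnor's `lim¹` sequence), which is renormalised once more. Everything is proved; no named facts.

## References

* J. Milnor, J. Stasheff, *Characteristic Classes*, PUP 1974, §10 Thm. 10.4, pp. 111–113. [MilnorStasheff1974]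
* D. Husemoller, *Fibre Bundles*, GTM 20, Springer 1994, Ch. 17 §2–§3. [HusemollerFibreBundles1994]
-/

noncomputable section

open CategoryTheory Function Set Bundle Literature.AlgebraicTopology.SingularHomology Literature.Topology
open scoped LinearAlgebra.Projectivization

universe u

namespace Literature.AlgebraicTopology.CharacteristicClasses

section Cover

variable {B : Type u} [TopologicalSpace B] (F : Type u) [NormedAddCommGroup F] (E : B → Type u)
  [TopologicalSpace (TotalSpace F E)] [∀ b, TopologicalSpace (E b)] [FiberBundle F E]

/-! ### The atlas cover and Milnor's countable cover by disjoint unions -/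

/-- The atlas trivialisations of `λ`, as an index type. [folklore] -/
abbrev AtlasIndex : Type _ := {e : Trivialization F (π F E) // MemTrivializationAtlas e}

/-- The base sets of the atlas trivialisations cover the base. [folklore] -/
theorem iUnion_baseSet_eq_univ : ⋃ i : AtlasIndex F E, i.1.baseSet = univ :=
  eq_univ_of_forall fun b ↦ mem_iUnion.2 ⟨⟨trivializationAt F E b, inferInstance⟩, mem_baseSet_trivializationAt F E b⟩

variable [T2Space B] [ParacompactSpace B]

/-- **Milnor's cover**: `W : Finset (atlas) → Set B`, open, `W S` inside an atlas base set for
`S ≠ ∅`, the `W S` with `|S| = k + 1` pairwise disjoint, all together covering `B`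
(`DisjointCountableRefinement.exists_nat_cover_by_disjoint_subordinate`). [cite: MilnorStasheff1974, §5 Lemma 5.9] -/
theorem exists_milnorCover :
    ∃ W : Finset (AtlasIndex F E) → Set B, (∀ S, IsOpen (W S)) ∧ (∀ S, S.Nonempty → ∃ i : AtlasIndex F E, W S ⊆ i.1.baseSet) ∧
      (∀ k : ℕ, ({S : Finset (AtlasIndex F E) | S.card = k + 1}).PairwiseDisjoint W) ∧
      (⋃ k : ℕ, ⋃ S ∈ {S : Finset (AtlasIndex F E) | S.card = k + 1}, W S) = univ :=
  exists_nat_cover_by_disjoint_subordinate (fun i : AtlasIndex F E ↦ i.1.baseSet) (fun i ↦ i.1.open_baseSet)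
    (iUnion_baseSet_eq_univ F E)

/-- A choice of Milnor cover. [folklore] -/
def milnorCover : Finset (AtlasIndex F E) → Set B := (exists_milnorCover F E).choose

/-- The Milnor cover consists of open sets. [folklore] -/
theorem isOpen_milnorCover (S : Finset (AtlasIndex F E)) : IsOpen (milnorCover F E S) :=
  (exists_milnorCover F E).choose_spec.1 S

/-- Each set of the Milnor cover (nonempty index) lies in an atlas base set. [folklore] -/
theorem milnorCover_subset {S : Finset (AtlasIndex F E)} (hS : S.Nonempty) :
    ∃ i : AtlasIndex F E, milnorCover F E S ⊆ i.1.baseSet :=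
  (exists_milnorCover F E).choose_spec.2.1 S hS

/-- The sets of one level are pairwise disjoint. [folklore] -/
theorem pairwiseDisjoint_milnorCover (k : ℕ) :
    ({S : Finset (AtlasIndex F E) | S.card = k + 1}).PairwiseDisjoint (milnorCover F E) :=
  (exists_milnorCover F E).choose_spec.2.2.1 k

/-- The Milnor cover covers. [folklore] -/
theorem iUnion_milnorCover :
    (⋃ k : ℕ, ⋃ S ∈ {S : Finset (AtlasIndex F E) | S.card = k + 1}, milnorCover F E S) = univ :=
  (exists_milnorCover F E).choose_spec.2.2.2

/-- The index type of the level-`k` pieces: finite sets of `k + 1` atlas trivialisations. [folklore] -/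
abbrev LevelIndex (k : ℕ) : Type _ := {S : Finset (AtlasIndex F E) // S.card = k + 1}

/-- The level-`k` pieces `W S`, `|S| = k + 1`. [folklore] -/
def levelPiece (k : ℕ) : LevelIndex F E k → Set B := fun S ↦ milnorCover F E S.1

/-- Level pieces are open. [folklore] -/
theorem isOpen_levelPiece (k : ℕ) (S : LevelIndex F E k) : IsOpen (levelPiece F E k S) := isOpen_milnorCover F E S.1

/-- Level pieces are pairwise disjoint. [folklore] -/
theorem pairwise_disjoint_levelPiece (k : ℕ) : Pairwise (Disjoint on levelPiece F E k) := fun S T hST ↦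
  pairwiseDisjoint_milnorCover F E k S.2 T.2 fun h ↦ hST (Subtype.ext h)

/-- Each level piece lies in an atlas base set. [folklore] -/
theorem levelPiece_subset (k : ℕ) (S : LevelIndex F E k) : ∃ i : AtlasIndex F E, levelPiece F E k S ⊆ i.1.baseSet :=
  milnorCover_subset F E (Finset.card_pos.1 (by rw [S.2]; exact Nat.succ_pos k))

/-- The level-`k` open set `W_k = ⋃_{|S| = k+1} W S`. [folklore] -/
def levelSet (k : ℕ) : Set B := ⋃ S : LevelIndex F E k, levelPiece F E k S

/-- `W_k` is open. [folklore] -/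
theorem isOpen_levelSet (k : ℕ) : IsOpen (levelSet F E k) := isOpen_iUnion fun S ↦ isOpen_levelPiece F E k S

/-- `⋃ W_k = B`. [folklore] -/
theorem iUnion_levelSet : ⋃ k, levelSet F E k = univ := by
  rw [← iUnion_milnorCover F E]
  refine iUnion_congr fun k ↦ Set.ext fun b ↦ ⟨fun hb ↦ ?_, fun hb ↦ ?_⟩
  · obtain ⟨S, hS⟩ := mem_iUnion.1 hb
    exact mem_iUnion₂.2 ⟨S.1, S.2, hS⟩
  · obtain ⟨S, hS, hb⟩ := mem_iUnion₂.1 hb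
    exact mem_iUnion.2 ⟨⟨S, hS⟩, hb⟩

/-- The exhaustion `V_n = W_0 ∪ ⋯ ∪ W_n`. [folklore] -/
def exhaustion : ℕ → Set B
  | 0 => levelSet F E 0
  | n + 1 => exhaustion n ∪ levelSet F E (n + 1)

/-- `V_{n+1} = V_n ∪ W_{n+1}`. [folklore] -/
theorem exhaustion_succ (n : ℕ) : exhaustion F E (n + 1) = exhaustion F E n ∪ levelSet F E (n + 1) := rfl

/-- `V_n` is open. [folklore] -/
theorem isOpen_exhaustion : ∀ n, IsOpen (exhaustion F E n)
  | 0 => isOpen_levelSet F E 0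
  | n + 1 => (isOpen_exhaustion n).union (isOpen_levelSet F E (n + 1))

/-- `V_n` is increasing. [folklore] -/
theorem monotone_exhaustion : Monotone (exhaustion F E) :=
  monotone_nat_of_le_succ fun _ ↦ subset_union_left

/-- `W_n ⊆ V_n`. [folklore] -/
theorem levelSet_subset_exhaustion : ∀ n, levelSet F E n ⊆ exhaustion F E n
  | 0 => subset_rfl
  | _ + 1 => subset_union_right

/-- `⋃ V_n = B`. [folklore] -/
theorem iUnion_exhaustion : ⋃ n, exhaustion F E n = univ :=
  eq_univ_of_forall fun b ↦ by
    obtain ⟨k, hk⟩ := mem_iUnion.1 ((iUnion_levelSet F E).symm ▸ mem_univ b)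
    exact mem_iUnion.2 ⟨k, levelSet_subset_exhaustion F E k hk⟩

end Cover

section Thom

variable {B : Type u} [TopologicalSpace B] (F : Type u) [NormedAddCommGroup F] [NormedSpace ℂ F] [FiniteDimensional ℂ F]
  (E : B → Type u) [∀ b, AddCommGroup (E b)] [∀ b, Module ℂ (E b)]
  [TopologicalSpace (TotalSpace F E)] [∀ b, TopologicalSpace (E b)] [FiberBundle F E] [VectorBundle ℂ F E]
  (hF : Module.finrank ℂ F = 1) (R : Type u) [CommRing R]

/-! ### Thom classes -/

/-- **Thom classes of the line bundle `λ` on `P(λ ⊕ ℂ)`** (absolute form): `t ∈ H²(P(λ ⊕ ℂ); R)` with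
`s_∞^* t = 0` restricting on every fibre to the canonical generator `ω_b(m)` (Milnor–Stasheff Thm. 9.1 /
10.4: "restriction to each fibre is the preferred generator"). [cite: MilnorStasheff1974, §10 Thm. 10.4] -/
structure IsThomClass (m : R) (t : singularCohomology R R (ProjCompl F E) 2) : Prop where
  map_complInf : singularCohomology.map R R (complInf F E hF) 2 t = 0
  map_complFibreIncl : ∀ b : B, singularCohomology.map R R (complFibreIncl F E b) 2 t = omegaFib F E hF R R b m

/-- `π ∘ (fibre over b) = const b` on `P(λ ⊕ ℂ)`. [folklore] -/
theorem complProj_comp_complFibreIncl (b : B) :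
    (complProj F E).comp (complFibreIncl F E b) = ContinuousMap.const _ b := rfl

/-- The fibre over `b ∈ S` of `P(λ ⊕ ℂ)` factors through `P(λ ⊕ ℂ)|_S`. [folklore] -/
theorem subsetIncl_comp_complFibOn {S : Set B} {b : B} (hb : b ∈ S) :
    (subsetIncl (complPreimage F E S)).comp (complFibOn hb) = complFibreIncl F E b := rfl

/-- The section at infinity over `S` followed by the inclusion is the section at infinity. [folklore] -/
theorem subsetIncl_comp_complInfOn (S : Set B) :
    (subsetIncl (complPreimage F E S)).comp (complInfOn F E hF S) = (complInf F E hF).comp (subsetIncl S) := rfl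


section Construction

variable [T2Space B] [ParacompactSpace B]

/-! ### Normalised classes on the levels and on the exhaustion -/

variable {F E}

/-- Each level piece is a uniqueness domain, and so is each of its open parts. [folklore] -/
theorem isUniq_inter_levelPiece (V : Set B) (k : ℕ) (S : LevelIndex F E k) : IsUniq F E hF R (V ∩ levelPiece F E k S) := by
  obtain ⟨i, hi⟩ := levelPiece_subset F E k S
  haveI := i.2
  exact isUniq_of_subset_baseSet hF R i.1 (inter_subset_right.trans hi)

/-- `V ∩ W_k` is a uniqueness domain for every open `V`. [folklore] -/
theorem isUniq_inter_levelSet {V : Set B} (hV : IsOpen V) (k : ℕ) : IsUniq F E hF R (V ∩ levelSet F E k) := by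
  rw [levelSet, inter_iUnion]
  exact isUniq_iUnion F E hF R (fun S ↦ hV.inter (isOpen_levelPiece F E k S))
    (fun S T hST ↦ (pairwise_disjoint_levelPiece F E k hST).mono inter_subset_right inter_subset_right)
    fun S ↦ isUniq_inter_levelPiece hF R V k S

/-- **A normalised class over each level `W_k`** (assemble the local Thom classes of the disjoint pieces).
[cite: MilnorStasheff1974, §10 Thm. 10.4] -/
theorem exists_isNormalised_levelSet (m : R) (k : ℕ) :
    ∃ x : singularCohomology R R ↥(complPreimage F E (levelSet F E k)) 2, IsNormalised F E hF R R (levelSet F E k) m x := by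
  have hloc : ∀ S : LevelIndex F E k, ∃ x : singularCohomology R R ↥(complPreimage F E (levelPiece F E k S)) 2,
      IsNormalised F E hF R R (levelPiece F E k S) m x := fun S ↦ by
    obtain ⟨i, hi⟩ := levelPiece_subset F E k S
    haveI := i.2
    exact ⟨localThomClass hF R R i.1 hi m, isNormalised_localThomClass hF i.1 hi m⟩
  choose x hx using hloc
  obtain ⟨y, hy, -⟩ := exists_isNormalised_iUnion F E hF R (isOpen_levelPiece F E k) (pairwise_disjoint_levelPiece F E k) x hx
  exact ⟨y, hy⟩

/-- **The inductive gluing along the exhaustion**: a normalised class over `V_n` for every `n`, the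
one over `V_{n+1} = V_n ∪ W_{n+1}` glued from the previous one and a class over `W_{n+1}`.
[cite: MilnorStasheff1974, §10 Thm. 10.4] -/
def thomSeq (m : R) : (n : ℕ) →
    {x : singularCohomology R R ↥(complPreimage F E (exhaustion F E n)) 2 // IsNormalised F E hF R R (exhaustion F E n) m x}
  | 0 => ⟨(exists_isNormalised_levelSet hF R m 0).choose, (exists_isNormalised_levelSet hF R m 0).choose_spec⟩
  | n + 1 =>
    let hex := exists_isNormalised_union F E hF R (isOpen_exhaustion F E n) (isOpen_levelSet F E (n + 1))
      (isUniq_inter_levelSet hF R (isOpen_exhaustion F E n) (n + 1)) (thomSeq m n).2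
      (exists_isNormalised_levelSet hF R m (n + 1)).choose_spec
    ⟨hex.choose, hex.choose_spec.1⟩

/-- **Exact compatibility**: the class over `V_{n+1}` restricts to the class over `V_n`. [cite: MilnorStasheff1974, §10 Thm. 10.4] -/
theorem thomSeq_restrict (m : R) (n : ℕ) :
    singularCohomology.map R R (complPreimageIncl (subset_union_left : exhaustion F E n ⊆ exhaustion F E (n + 1))) 2
      (thomSeq hF R m (n + 1)).1 = (thomSeq hF R m n).1 :=
  (exists_isNormalised_union F E hF R (isOpen_exhaustion F E n) (isOpen_levelSet F E (n + 1))
      (isUniq_inter_levelSet hF R (isOpen_exhaustion F E n) (n + 1)) (thomSeq hF R m n).2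
      (exists_isNormalised_levelSet hF R m (n + 1)).choose_spec).choose_spec.2.1

/-! ### The Thom class -/

variable (F E)

/-- **Existence of the Thom class of a complex line bundle over a paracompact Hausdorff base**
(Milnor–Stasheff Thm. 10.4, existence half, in the absolute form on `P(λ ⊕ ℂ)`): lift the compatible
normalised classes of the exhaustion (`CohomologyOpenExhaustion`) and renormalise.
[cite: MilnorStasheff1974, §10 Thm. 10.4] -/
theorem exists_isThomClass (m : R) : ∃ t : singularCohomology R R (ProjCompl F E) 2, IsThomClass F E hF R m t := by
  -- the open exhaustion of the total space and the compatible classes on it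
  set V' : ℕ → Set (ProjCompl F E) := fun n ↦ complPreimage F E (exhaustion F E n) with hV'
  have hV'o : ∀ n, IsOpen (V' n) := fun n ↦ (isOpen_exhaustion F E n).preimage (complProj F E).continuous
  have hmono : Monotone V' := fun a b hab ↦ preimage_mono (monotone_exhaustion F E hab)
  have hcov : ⋃ n, V' n = univ := by
    rw [hV']
    change ⋃ n, TotalSpace.proj ⁻¹' exhaustion F E n = univ
    rw [← preimage_iUnion, iUnion_exhaustion F E, preimage_univ]
  obtain ⟨t₀, ht₀⟩ := singularCohomology.exists_forall_map_subsetIncl_eq_of_exhaustion hV'o hmono hcov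
    (fun n ↦ (thomSeq hF R m n).1) fun n ↦ thomSeq_restrict hF R m n
  -- renormalise
  refine ⟨t₀ - singularCohomology.map R R (complProj F E) 2 (singularCohomology.map R R (complInf F E hF) 2 t₀), ?_, fun b ↦ ?_⟩
  · rw [map_sub, ← ModuleCat.comp_apply (singularCohomology.map R R (complProj F E) 2), ← singularCohomology.map_comp,
      complProj_comp_complInf, singularCohomology.map_id, ModuleCat.id_apply, sub_self]
  · obtain ⟨n, hn⟩ := mem_iUnion.1 ((iUnion_exhaustion F E).symm ▸ mem_univ b)
    rw [map_sub, ← ModuleCat.comp_apply (singularCohomology.map R R (complProj F E) 2), ← singularCohomology.map_comp,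
      complProj_comp_complFibreIncl, singularCohomology.map_const_eq_zero R R _ two_ne_zero, sub_zero,
      ← subsetIncl_comp_complFibOn F E hn, singularCohomology.map_comp, ModuleCat.comp_apply, ht₀ n,
      (thomSeq hF R m n).2.map_complFibOn b hn]

end Construction

end Thom

end Literature.AlgebraicTopology.CharacteristicClasses
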